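import Summits.ResolutionOfSingularities.ResolutionOfSingularities.Theorems.FrobeniusClosingSteerGeoDictResidueField
import Summits.ResolutionOfSingularities.ResolutionOfSingularities.Theorems.FrobeniusClosingSteerGeoDictShorts
import Literature.FieldTheory.Separability.PDegreeSeparablyGenerated
import Literature.RingTheory.KrullDimension.AffineCatenary
import Mathlib.LinearAlgebra.Dimension.Finrank
import Mathlib.RingTheory.LocalRing.ResidueField.Ideal
import HarnessLib

/-!
# Crux `Steer` (stmt-ResolutionOfSingularities-16345), chain W4.1, R2 σ_top line, piece G⁺ `GeoDictFinrank` — G11d, the RESIDUE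
# p-RANK of a chain ring: `[κ(R_P) : κ(R_P)^p] = p ^ (n − c)` (Theses-free)

OURS (campaign `res-hironaka`, rung L ★L-G4, slot W4.1, chain W4.1, seat `res-type-096`; replaces the role of no printed item; NOT a
statement of the manuscript under review; AI review is weaker than expert review). Object: res-L0-w41-plan-1 RULING 2026-08-27T06:31:15Z
(3) — the line of record on T is PACKAGE (II): K(3) := `NoEternalIsolatedRadicandChainFinrank p 3 1` (idea-1 §σ2.13b) and
G⁺ := `GeoDictFinrank` (res-D-pv-011 AS res-L0-w41-stub-7 assembles, over the G10 construction `GeoDict.not_noEternalChain_of_dominantTail`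
p503815), whose ONE extra output per member `m` is

  `Module.finrank (frobenius κ_m p).fieldRange κ_m = p ^ (n − c)`,   `κ_m = ResidueField (S m)`,

for the chain rings `S m = (R (i₀+m))_{P (i₀+m)} ⊆ K` of a dominant tail of height `c` in an `n`-dimensional core datum over a PERFECT
ground field `k` of characteristic `p`. «096 files G11 as the brick, pv-011 assembles.» This file is that brick, over the SAME def-free
interface as G0–G11 (`hT : ∀ z, z ∈ T ↔ ∃ a b : R, b ∉ P ∧ z = a / b`, `hR : locAtCentre A.toSubring O = R`, `A : Subalgebra k K`
finitely generated — the model of the member from `SteeredExit.exists_model_of_tower`):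

* `GeoDict.charP_residueField_of_locChar` — `κ(T)` has characteristic `p` (the instance binder `[∀ m, CharP (ResidueField (S m)) p]`
  of the K(3) statement; `k → T → κ(T)` is injective);
* `GeoDict.finrank_frobenius_fieldRange_eq_of_ringEquiv` — `[F : F^p]` is invariant under ring isomorphisms (Mathlib
  `Algebra.finrank_eq_of_equiv_equiv`, the isomorphism restricted to the subfields of `p`-th powers);
* `GeoDict.height_comap_model_eq_of_locChar` — for `Q = P ∩ A`: `height Q = height P` (both equal `dim T`, since `T = R_P = A_Q`:
  `GeoDict.ringKrullDim_of_locChar` twice — no catenarity needed);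
* `GeoDict.ringKrullDim_model_quotient_eq_of_locChar` — `dim (A ⧸ Q) = n − c` when `dim A = n`, `height P = c` (affine dimension
  formula, tree `Literature.RingTheory.KrullDimension.ringKrullDim_quotient_add_height`, Matsumura Thm. 5.6);
* **`GeoDict.finrank_frobenius_residueField_of_locChar`** — `[κ(T) : κ(T)^p] = p ^ (n − c)`: res-D-pv-004 AS res-L0-w41-stub-10's
  `finrank_frobenius_residueField_eq_pow` (p500784; Matsumura Thm. 26.5 + Thm. 5.6) at the model prime `Q`, transported along
  `κ(Q) = ResidueField (Localization.AtPrime Q) ≃+* ResidueField T` (`IsLocalization.algEquiv`, `ResidueField.mapEquiv`).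

Assembler's recipe per member (all names in the tree): `obtain ⟨A₁, -, h01, hfg₁, hRA₁⟩ := SteeredExit.exists_model_of_tower … (N := i₀ + m) …`,
`hn := TailCodim.ringKrullDim_eq_of_model A₀ A₁ h01 hp.pos htp hfr hfg₁ htr` (p503921), `hc := hht _ _`, then this theorem with `(hS m)`.
No named fact; axioms standard. [cite: Matsumura1987, Thm. 26.5 and Thm. 5.6] [cite: StacksProject, Tag 07QU] [folklore]
-/

noncomputable section

-- `Summit.<S>.<S>.…` duplicates the summit name by design (single-problem summit).
set_option linter.dupNamespace false

open IsLocalRing Module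

namespace Summit.ResolutionOfSingularities.ResolutionOfSingularities.Theorems.SwitchingDichotomy

open Literature.AlgebraicGeometry.Resolution
open Literature.FieldTheory.Separability

namespace GeoDict

universe u v w

/-! ## `[F : F^p]` is invariant under ring isomorphisms -/

/-- **`[F : F^p] = [F' : F'^p]` along a ring isomorphism `e : F ≃+* F'`**: `e` maps the subfield of `p`-th powers of `F` onto that of
`F'`, compatibly with the inclusions. [folklore] -/
theorem finrank_frobenius_fieldRange_eq_of_ringEquiv {F : Type v} {F' : Type w} [Field F] [Field F'] (p : ℕ)
    [ExpChar F p] [ExpChar F' p] (e : F ≃+* F') :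
    finrank (frobenius F p).fieldRange F = finrank (frobenius F' p).fieldRange F' := by
  have hmem : ∀ x : F, x ∈ (frobenius F p).fieldRange → e x ∈ (frobenius F' p).fieldRange := by
    rintro _ ⟨y, rfl⟩
    exact ⟨e y, by rw [frobenius_def, frobenius_def, map_pow]⟩
  have hmem' : ∀ x : F', x ∈ (frobenius F' p).fieldRange → e.symm x ∈ (frobenius F p).fieldRange := by
    rintro _ ⟨y, rfl⟩
    exact ⟨e.symm y, by rw [frobenius_def, frobenius_def, map_pow]⟩
  let i : (frobenius F p).fieldRange ≃+* (frobenius F' p).fieldRange :=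
    { toFun := fun x => ⟨e x, hmem x x.2⟩
      invFun := fun y => ⟨e.symm y, hmem' y y.2⟩
      left_inv := fun x => Subtype.ext (e.symm_apply_apply (x : F))
      right_inv := fun y => Subtype.ext (e.apply_symm_apply (y : F'))
      map_mul' := fun x y => Subtype.ext (map_mul e (x : F) y)
      map_add' := fun x y => Subtype.ext (map_add e (x : F) y) }
  exact Algebra.finrank_eq_of_equiv_equiv i e (RingHom.ext fun x => rfl)

variable {K : Type u} [Field K] {k : Type u} [Field k] [Algebra k K]

section PRank

variable (p : ℕ) (O : ValuationSubring K) (A : Subalgebra k K) {R : Subring K} (hR : locAtCentre A.toSubring O = R)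
  {P : Ideal R} [hP : P.IsPrime] {T : Subring K} (hT : ∀ z : K, z ∈ T ↔ ∃ a b : R, b ∉ P ∧ z = (a : K) / b)
include hR hT

/-- **`κ(R_P)` has characteristic `p`** when the ground field has: `k → R_P → κ(R_P)` is an injective ring map out of a field.
(The instance binder `[∀ m, CharP (ResidueField (S m)) p]` of `NoEternalIsolatedRadicandChainFinrank`.) [folklore] -/
theorem charP_residueField_of_locChar [CharP k p] [IsLocalRing T] : CharP (ResidueField T) p := by
  letI : Algebra k T := ((algebraMap k K).codRestrict T (algebraMap_mem_of_locChar O A hR hT)).toAlgebra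
  exact charP_of_injective_algebraMap (algebraMap k (ResidueField T)).injective p

omit hT in
/-- The trace `Q = P ∩ A` of a prime of `R = A_{𝔪_O ∩ A}` on the model is prime. [folklore] -/
theorem comap_model_isPrime : (P.comap (Subring.inclusion (model_le_of_locAtCentre_eq O A hR))).IsPrime :=
  Ideal.comap_isPrime _ _

/-- **`height (P ∩ A) = height P`**: both are the Krull dimension of `T = R_P = A_{P ∩ A}`. [folklore] -/
theorem height_comap_model_eq_of_locChar :
    (P.comap (Subring.inclusion (model_le_of_locAtCentre_eq O A hR))).height = P.height := by
  haveI := comap_model_isPrime O A hR (P := P)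
  have h1 : ringKrullDim T = P.height := ringKrullDim_of_locChar hT
  have h2 : ringKrullDim T = (P.comap (Subring.inclusion (model_le_of_locAtCentre_eq O A hR))).height :=
    ringKrullDim_of_locChar (locChar_model_of_locChar O A hR hT)
  rw [h1] at h2
  exact_mod_cast h2.symm

/-- **`dim (A ⧸ (P ∩ A)) = n − c`** for a finitely generated model `A` of dimension `n` and a prime `P` of `R = A_{𝔪_O ∩ A}` of
height `c`: the affine domain `A ⊆ K` satisfies the dimension formula `dim (A ⧸ Q) + height Q = dim A` (Matsumura Thm. 5.6).
[cite: Matsumura1987, Thm. 5.6] -/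
theorem ringKrullDim_model_quotient_eq_of_locChar (hfg : A.FG) {n c : ℕ} (hn : ringKrullDim A = n) (hc : P.height = c) :
    ringKrullDim (A.toSubring ⧸ P.comap (Subring.inclusion (model_le_of_locAtCentre_eq O A hR))) = (n - c : ℕ) := by
  haveI := comap_model_isPrime O A hR (P := P)
  set Q := P.comap (Subring.inclusion (model_le_of_locAtCentre_eq O A hR)) with hQ
  have hQc : Q.height = c := by rw [hQ, height_comap_model_eq_of_locChar O A hR hT, hc]
  letI : Algebra k A.toSubring := A.algebra
  haveI : Algebra.FiniteType k A.toSubring := A.fg_iff_finiteType.mp hfg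
  have hn' : ringKrullDim A.toSubring = n := hn
  have hcat := Literature.RingTheory.KrullDimension.ringKrullDim_quotient_add_height k Q
  rw [hQc, hn'] at hcat
  obtain ⟨d, hd, -⟩ := Literature.RingTheory.KrullDimension.exists_ringKrullDim_eq_and_trdeg_eq k (A.toSubring ⧸ Q)
  rw [hd] at hcat
  have hdc : d + c = n := by
    have h' : ((d + c : ℕ) : WithBot ℕ∞) = (n : ℕ) := by
      rw [← hcat]
      rfl
    exact_mod_cast h'
  rw [hd]
  congr 2
  omega

/-- **G11d — the residue p-rank of a chain ring: `[κ(R_P) : κ(R_P)^p] = p ^ (n − c)`.** For a perfect ground field `k` of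
characteristic `p`, a finitely generated model `A ⊆ K` of Krull dimension `n`, `R = A_{𝔪_O ∩ A}`, a prime `P` of `R` of height `c` and
the chain ring `T = R_P ⊆ K`: the residue field `κ(T)` has degree `p ^ (n − c)` over its subfield of `p`-th powers — literally the
per-member hypothesis of `NoEternalIsolatedRadicandChainFinrank p c (n − c)` (idea-1 §σ2.13b). Route: `κ(T) ≃ κ(P ∩ A)` (`T = A_{P∩A}`),
`dim (A ⧸ (P ∩ A)) = n − c`, and res-L0-w41-stub-10's `finrank_frobenius_residueField_eq_pow` (Matsumura Thm. 26.5: `[κ : κ^p] =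
p^{trdeg_k κ}` for `κ` finitely generated over perfect `k`, `trdeg_k κ(Q) = dim A/Q` by Thm. 5.6).
[cite: Matsumura1987, Thm. 26.5 and Thm. 5.6] [folklore] -/
theorem finrank_frobenius_residueField_of_locChar [Fact p.Prime] [CharP k p] [PerfectField k] (hfg : A.FG) {n c : ℕ}
    (hn : ringKrullDim A = n) (hc : P.height = c) [IsLocalRing T] [CharP (ResidueField T) p] :
    finrank (frobenius (ResidueField T) p).fieldRange (ResidueField T) = p ^ (n - c) := by
  haveI := comap_model_isPrime O A hR (P := P)
  set Q := P.comap (Subring.inclusion (model_le_of_locAtCentre_eq O A hR)) with hQ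
  have hT' : ∀ z : K, z ∈ T ↔ ∃ a b : A.toSubring, b ∉ Q ∧ z = (a : K) / b := locChar_model_of_locChar O A hR hT
  have hd : ringKrullDim (A.toSubring ⧸ Q) = (n - c : ℕ) := ringKrullDim_model_quotient_eq_of_locChar O A hR hT hfg hn hc
  -- the model as a finitely generated `k`-algebra, and `κ(Q)` of characteristic `p`
  letI : Algebra k A.toSubring := A.algebra
  haveI : Algebra.FiniteType k A.toSubring := A.fg_iff_finiteType.mp hfg
  haveI : CharP Q.ResidueField p :=
    charP_of_injective_ringHom
      (((algebraMap A.toSubring Q.ResidueField).comp (algebraMap k A.toSubring)).injective) p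
  have hfin : finrank (frobenius Q.ResidueField p).fieldRange Q.ResidueField = p ^ (n - c) :=
    finrank_frobenius_residueField_eq_pow (k := k) p Q hd
  -- `T = A_Q`, so `κ(Q) = ResidueField (Localization.AtPrime Q) ≃+* ResidueField T`
  letI : Algebra A.toSubring T := (Subring.inclusion (le_of_locChar hT')).toAlgebra
  haveI : IsLocalization.AtPrime T Q := isLocalization_of_locChar hT' fun r => rfl
  let e : Q.ResidueField ≃+* ResidueField T :=
    ResidueField.mapEquiv (IsLocalization.algEquiv Q.primeCompl (Localization.AtPrime Q) T).toRingEquiv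
  rw [← finrank_frobenius_fieldRange_eq_of_ringEquiv p e]
  exact hfin

end PRank

end GeoDict

end Summit.ResolutionOfSingularities.ResolutionOfSingularities.Theorems.SwitchingDichotomy

end
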